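import Summits.Ventures.Crystal3D.Theorems.StickyWulffConstantCoaxialWallLawSeamFullCensusVacLeaf
import HarnessLib

/-!
# FULL-CENSUS SOUNDNESS, part A: frame tables of the checker = tables of the rational frames; list bookkeeping; the interpretation `Inv` of a state; witnessed
# conflicts are contradictions
# (crux `CoaxialWallLaw`, stmt-Ventures-19481; lane F 'Certificates' v8.4, registered stub `stub_satCensus11Full : TailResidue.SatCensus11Full`)

HONEST FRAMING. Venture `Summits/Ventures/Crystal3D` (cell `crystal3d-full`); helper for `stub_satCensus11Full`; sequel of '…SeamFullCensusVacLeaf'.  §1 `tabOK_tabs`: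
the checker's tables `tabs κ` ARE the `g`/`w` tables of `RatFrame.base.reflect … .reflect` (chain `κ`), `sc`/`ss` are the lane's `dz` products, `mir3` is `mirQ`;
§2 membership / `Nodup` lemmas for `insertV`, `addAll`, `fullList`, `ownList`, `mirList`, `farList` (after which these are made irreducible for the elaborator);
§3 `Hyp` (global hypotheses: separation, E1, GAP(5/2), `VacancyCapTwin`, `deg b = 11`, unsaturated contacts of `b` coincide) and `Inv` (interpretation of a state);
§4 `false_of_checkW`: every witnessed conflict accepted by `checkW` is a contradiction ('…Kit' closures).  Part B ('…SeamFullCensusSound') proves `run_sound`.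
WHAT THIS IS NOT: no census statement is proved here; F-C1 not moved.
-/

noncomputable section

namespace Summit.Ventures.Crystal3D.Theorems

namespace TailResidue

namespace FullCensus

open Summit.Ventures.Crystal3D Finset EndRowFloor NearIdentity
open scoped InnerProductSpace

variable {X : Finset (EuclideanSpace ℝ (Fin 3))} {G' : EuclideanSpace ℝ (Fin 3) ≃ₗᵢ[ℝ] EuclideanSpace ℝ (Fin 3)} {q₀ : EuclideanSpace ℝ (Fin 3)}

/-! ### §1 Frame tables -/

/-- `rq3` is `rq` on `toV`. -/
theorem toV_rq3 (n v : Q3) : (rq3 n v).toV = rq n.toV v.toV := by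
  ext i; fin_cases i <;> simp [rq3, rq, Q3.toV, Q3.sub, Q3.smul, Q3.dot, dq]

/-- The rational frame reached from the base frame by a reflection chain (entries `≥ 8` are skipped). -/
def frameChainN : List ℕ → RatFrame → RatFrame
  | [], F => F
  | c :: κ, F => frameChainN κ (if h : c < 8 then F.reflect ⟨c, h⟩ else F)

/-- The correspondence between a rational frame and a pair of tables. -/
def TabOK (F : RatFrame) (t : List Q3 × List Q3) : Prop :=
  t.1.length = 12 ∧ t.2.length = 8 ∧ (∀ i : Fin 12, F.g i = (gOf t i).toV) ∧ ∀ c : Fin 8, F.w c = (wOf t c).toV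

/-- `getD` of a mapped list inside its range. -/
theorem getD_map_of_lt {f : Q3 → Q3} {L : List Q3} {i : ℕ} (hi : i < L.length) (d : Q3) : (L.map f).getD i d = f (L.getD i d) := by
  rw [List.getD_eq_getElem _ _ (by simpa using hi), List.getD_eq_getElem _ _ hi, List.getElem_map]

/-- Reflecting with the zero vector does nothing. -/
theorem rq3_zero (v : Q3) : rq3 ⟨0, 0, 0⟩ v = v := by
  cases v; simp [rq3, Q3.sub, Q3.smul, Q3.dot]

/-- One step of the correspondence. -/
theorem tabOK_step {F : RatFrame} {t : List Q3 × List Q3} (h : TabOK F t) (c : ℕ) :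
    TabOK (if hc : c < 8 then F.reflect ⟨c, hc⟩ else F) (tabStep t c) := by
  obtain ⟨h1, h2, hg, hw⟩ := h
  refine ⟨by simp [tabStep, h1], by simp [tabStep, h2], fun i => ?_, fun c' => ?_⟩
  · show _ = (((t.1.map (rq3 (t.2.getD c ⟨0, 0, 0⟩))).getD i ⟨0, 0, 0⟩)).toV
    rw [getD_map_of_lt (by rw [h1]; exact i.2)]
    by_cases hc : c < 8
    · rw [dif_pos hc]
      show rq (F.w ⟨c, hc⟩) (F.g i) = _
      rw [toV_rq3, hg, hw ⟨c, hc⟩]; rfl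
    · rw [dif_neg hc, List.getD_eq_default _ _ (by rw [h2]; omega), rq3_zero, hg]; rfl
  · show _ = (((t.2.map (rq3 (t.2.getD c ⟨0, 0, 0⟩))).getD c' ⟨0, 0, 0⟩)).toV
    rw [getD_map_of_lt (by rw [h2]; exact c'.2)]
    by_cases hc : c < 8
    · rw [dif_pos hc]
      show rq (F.w ⟨c, hc⟩) (F.w c') = _
      rw [toV_rq3, hw c', hw ⟨c, hc⟩]; rfl
    · rw [dif_neg hc, List.getD_eq_default _ _ (by rw [h2]; omega), rq3_zero, hw]; rfl

/-- The base case of the correspondence. -/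
theorem tabOK_base : TabOK RatFrame.base tabBase := by
  refine ⟨rfl, rfl, fun i => ?_, fun c => ?_⟩
  · show gBase i = _
    ext j
    fin_cases i <;> fin_cases j <;> simp [gBase, castQ, slot3, slotInt, tabBase, gOf, slotQ3, Q3.smul, Q3.toV]
  · show wBase c = _
    ext j
    fin_cases c <;> fin_cases j <;> simp [wBase, castQ, cubeInt, tabBase, wOf, cubeQ3, Q3.toV]

/-- **The checker's tables are the tables of the rational frame of the chain.** -/
theorem tabOK_chain (κ : List ℕ) : ∀ (F : RatFrame) (t : List Q3 × List Q3), TabOK F t → TabOK (frameChainN κ F) (κ.foldl tabStep t) := by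
  induction κ with
  | nil => intro F t h; exact h
  | cons c κ ih => intro F t h; exact ih _ _ (tabOK_step h c)

/-- The frame of the chain `κ`. -/
def frameOf (κ : List ℕ) : RatFrame := frameChainN κ RatFrame.base

/-- `tabs κ` are its tables. -/
theorem tabOK_tabs (κ : List ℕ) : TabOK (frameOf κ) (tabs κ) := tabOK_chain κ _ _ tabOK_base

/-- The integer menu values of the checker are the lane's. -/
theorem sc_eq : ∀ (i : Fin 12) (c : Fin 8), sc i c = (dz (slotInt i) (cubeInt c) : ℚ) := by decide +kernel

/-- The slot products of the checker are the lane's. -/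
theorem ss_eq : ∀ (i j : Fin 12), ss i j = (dz (slotInt i) (slotInt j) : ℚ) := by decide +kernel

/-- Mirror positions of the checker are the lane's `mirQ`. -/
theorem toV_mir3 (κ : List ℕ) (i : Fin 12) (c : Fin 8) : (mir3 (tabs κ) i c).toV = mirQ (frameOf κ).g (frameOf κ).w i c := by
  obtain ⟨_, _, hg, hw⟩ := tabOK_tabs κ
  rw [mir3, mirQ, Q3.toV_sub, Q3.toV_smul, hg, hw, sc_eq]
  push_cast
  rfl

/-! ### §2 List bookkeeping -/

/-- Membership in `insertV`. -/
theorem mem_insertV {a v : Q3} {L : List Q3} : a ∈ insertV v L ↔ a = v ∨ a ∈ L := by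
  unfold insertV
  split_ifs with h
  · constructor
    · intro ha; exact Or.inr ha
    · rintro (rfl | ha); exacts [h, ha]
  · simp

/-- `insertV` preserves `Nodup`. -/
theorem nodup_insertV {v : Q3} {L : List Q3} (h : L.Nodup) : (insertV v L).Nodup := by
  unfold insertV
  split_ifs with hv
  · exact h
  · exact List.nodup_cons.2 ⟨hv, h⟩

/-- Membership in `addAll`. -/
theorem mem_addAll {a : Q3} {L vs : List Q3} : a ∈ addAll L vs ↔ a ∈ L ∨ a ∈ vs := by
  induction vs with
  | nil => simp [addAll]
  | cons v vs ih =>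
    show a ∈ insertV v (addAll L vs) ↔ _
    rw [mem_insertV, ih]
    simp only [List.mem_cons]
    tauto

/-- `addAll` preserves `Nodup`. -/
theorem nodup_addAll {L vs : List Q3} (h : L.Nodup) : (addAll L vs).Nodup := by
  induction vs with
  | nil => exact h
  | cons v vs ih => exact nodup_insertV ih

/-- Membership in a list built from `List.range 12`. -/
theorem mem_map_range {a : Q3} {P : ℕ → Bool} {f : ℕ → Q3} :
    a ∈ ((List.range 12).filter P).map f ↔ ∃ i : Fin 12, P i = true ∧ a = f i := by
  simp only [List.mem_map, List.mem_filter, List.mem_range]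
  constructor
  · rintro ⟨i, ⟨hi, hP⟩, rfl⟩; exact ⟨⟨i, hi⟩, hP, rfl⟩
  · rintro ⟨i, hP, rfl⟩; exact ⟨i, ⟨i.2, hP⟩, rfl⟩

/-- Membership in `fullList`. -/
theorem mem_fullList {a : Q3} {t : List Q3 × List Q3} {p : Q3} : a ∈ fullList t p ↔ ∃ i : Fin 12, a = Q3.add p (gOf t i) := by
  simp only [fullList, List.mem_map, List.mem_range]
  constructor
  · rintro ⟨i, hi, rfl⟩; exact ⟨⟨i, hi⟩, rfl⟩
  · rintro ⟨i, rfl⟩; exact ⟨i, i.2, rfl⟩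

/-- Membership in `ownList`. -/
theorem mem_ownList {a : Q3} {t : List Q3 × List Q3} {p : Q3} {c : ℕ} :
    a ∈ ownList t p c ↔ ∃ i : Fin 12, decide (sc i c ≤ 0) = true ∧ a = Q3.add p (gOf t i) := mem_map_range

/-- Membership in `mirList`. -/
theorem mem_mirList {a : Q3} {t : List Q3 × List Q3} {p : Q3} {c : ℕ} :
    a ∈ mirList t p c ↔ ∃ i : Fin 12, decide (sc i c < 0) = true ∧ a = Q3.add p (mir3 t i c) := mem_map_range

/-- Membership in `farList`. -/
theorem mem_farList {a : Q3} {t : List Q3 × List Q3} {p : Q3} {c : ℕ} :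
    a ∈ farList t p c ↔ ∃ i : Fin 12, decide (0 < sc i c) = true ∧ a = Q3.add p (gOf t i) := mem_map_range

-- From here on the list operations of the checker are never unfolded on symbolic arguments (unification would otherwise try to decide memberships of
-- open terms): only the membership lemmas above are used.
attribute [local irreducible] insertV addAll fullList ownList mirList farList tabs

/-! ### §3 The interpretation of a state -/

/-- **Global hypotheses** of the census situation, read through `TT`. -/
structure Hyp (X : Finset (EuclideanSpace ℝ (Fin 3))) (G' : EuclideanSpace ℝ (Fin 3) ≃ₗᵢ[ℝ] EuclideanSpace ℝ (Fin 3)) (q₀ : EuclideanSpace ℝ (Fin 3)) : Prop where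
  /-- `1`-separation -/
  sep : ∀ p ∈ X, ∀ p' ∈ X, p ≠ p' → 1 ≤ dist p p'
  /-- E1 -/
  e1 : P5Exhaustion
  /-- GAP(5/2) -/
  gap : KissingGap (5 / 2)
  /-- the twin vacancy cap certificate -/
  cap : VacancyCapTwin
  /-- the end ball is in `X` -/
  bmem : TT G' q₀ bQ ∈ X
  /-- the end ball has exactly eleven contacts -/
  deg : (X.filter fun z => dist (TT G' q₀ bQ) z = 1).card = 11
  /-- any two unsaturated contacts of the end ball coincide -/
  one : ∀ y ∈ X, ∀ y' ∈ X, dist (TT G' q₀ bQ) y = 1 → dist (TT G' q₀ bQ) y' = 1 →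
    (X.filter fun z => dist y z = 1).card ≤ 11 → (X.filter fun z => dist y' z = 1).card ≤ 11 → y = y'

/-- **The interpretation of a checker state.** -/
structure Inv (X : Finset (EuclideanSpace ℝ (Fin 3))) (G' : EuclideanSpace ℝ (Fin 3) ≃ₗᵢ[ℝ] EuclideanSpace ℝ (Fin 3)) (q₀ : EuclideanSpace ℝ (Fin 3)) (st : St) :
    Prop where
  /-- present balls are in `X` -/
  pres : ∀ a ∈ st.pres, TT G' q₀ a ∈ X
  /-- no duplicates -/
  nodup : st.pres.Nodup
  /-- saturated balls have twelve contacts -/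
  sat : ∀ a ∈ st.sat, TT G' q₀ a ∈ X ∧ (X.filter fun z => dist (TT G' q₀ a) z = 1).card = 12
  /-- known dozens: the centre is a saturated ball of `X` and every contact is listed -/
  dzn : ∀ pd ∈ st.dzn, (TT G' q₀ pd.1 ∈ X ∧ (X.filter fun z => dist (TT G' q₀ pd.1) z = 1).card = 12) ∧
    ∀ z ∈ X, dist (TT G' q₀ pd.1) z = 1 → ∃ u ∈ pd.2, z = TT G' q₀ u
  /-- empty positions -/
  emp : ∀ a ∈ st.emp, TT G' q₀ a ∉ X
  /-- the designated ball is an unsaturated contact of the end ball -/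
  uns : ∀ u, st.uns = some u → TT G' q₀ u ∈ X ∧ Q3.d2 bQ u = 18 ∧ (X.filter fun z => dist (TT G' q₀ u) z = 1).card ≤ 11

/-! ### §4 Soundness of the leaves and of the E1 bookkeeping -/

open scoped Classical in
/-- Witnessed conflicts are contradictions. -/
theorem false_of_checkW (hyp : Hyp X G' q₀) {st : St} (hinv : Inv X G' q₀ st) : ∀ w : Witness, checkW st w = true → False := by
  intro w hw
  cases w with
  | sep u v =>
    simp only [checkW, Bool.and_eq_true, decide_eq_true_eq] at hw
    obtain ⟨⟨⟨hu, hv⟩, hne⟩, hlt⟩ := hw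
    refine false_of_sep G' q₀ hyp.sep (hinv.pres u hu) (hinv.pres v hv) (fun h => hne (Q3.toV_injective h)) ?_
    rw [Q3.dq_toV_sub]; exact hlt
  | emp u =>
    simp only [checkW, Bool.and_eq_true, decide_eq_true_eq] at hw
    exact hinv.emp u hw.2 (hinv.pres u hw.1)
  | dzn p x =>
    simp only [checkW, Bool.and_eq_true, decide_eq_true_eq, List.any_eq_true, Bool.not_eq_true', decide_eq_false_iff_not] at hw
    obtain ⟨⟨hx, hd⟩, pd, hpd, hp1, hnot⟩ := hw
    have hdist : dist (TT G' q₀ pd.1) (TT G' q₀ x) = 1 := by rw [dist_TT_eq_one_iff, hp1, Q3.d2_comm]; exact hd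
    obtain ⟨u, hu, he⟩ := (hinv.dzn pd hpd).2 _ (hinv.pres x hx) hdist
    exact hnot ((TT_injective G' q₀ he) ▸ hu)
  | gap p x =>
    simp only [checkW, Bool.and_eq_true, decide_eq_true_eq] at hw
    obtain ⟨⟨⟨hp, hx⟩, hlo⟩, hhi⟩ := hw
    obtain ⟨hpX, hp12⟩ := hinv.sat p hp
    refine false_of_gap G' q₀ hyp.gap hyp.sep hpX hp12 (hinv.pres x hx) ?_ ?_ <;> rw [Q3.dq_toV_sub]
    exacts [hlo, hhi]
  | count =>
    simp only [checkW, decide_eq_true_eq] at hw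
    set L := st.pres.filter fun v => decide (Q3.d2 bQ v = 18) with hL
    refine false_of_twelve_contacts G' q₀ (L.map Q3.toV) ((List.nodup_map_iff Q3.toV_injective).2 (hinv.nodup.filter _)) (by simpa using hw)
      (fun v hv => ?_) (fun v hv => ?_) hyp.deg
    · obtain ⟨a, ha, rfl⟩ := List.mem_map.1 hv
      exact hinv.pres a (List.mem_filter.1 ha).1
    · obtain ⟨a, ha, rfl⟩ := List.mem_map.1 hv
      rw [Q3.dq_toV_sub]; exact of_decide_eq_true (List.mem_filter.1 ha).2

end FullCensus

end TailResidue

end Summit.Ventures.Crystal3D.Theorems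

end
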